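import Literature.MathematicalPhysics.QuantumFieldTheory.Balaban1983to89.T4ShellMeasure
import Mathlib.Analysis.Convex.Topology
import Mathlib.Analysis.SpecialFunctions.Log.Basic
import Mathlib.LinearAlgebra.Matrix.Symmetric

/-!
# N21 (NE7c) · a LOW CENTRE suffices for radial non-collapse; the linear centre; kept letters split by support
# (lens Cards 81–83 ∕ ROW P″ — the natural sibling of parts 27–29)

R134 seat pub-ymgap-dag-n21-d (g8), node N21 = NE7c (single-run shell-weight bound, NOT PRINTED in [Bałaban 1983–89],
NOT proved), lane K3⁷ `SpineGivenEndpointR13SepCoPH` (stmt-QuantumFields-20544, `--kind proof --supports … --as helper`).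
Part 30 of the comparison series.  THIS FILE = §A + §B + §C of the lens's `Sketch-nearmiss-g28.lean` (LENS-nearmiss v28.0
ROW P″; first refusal dag-n21-d) — farm rc 0 · 0 warnings at the lens desk — VERBATIM, statements and proofs, re-homed
in this namespace.  AUTHORSHIP OF THE MATHEMATICS: planner seat `ym-lens-BalabanUVNodes-nearmiss` g28 (memo-only seat,
cannot file); this seat only files.

WHAT (lens, state W²⁶: the centre need not be the minimiser).  Part 28 proves (M1) on the cut law from non-collapse,
envelope, transversality and odds about a measurable centre.  §A (Card 81): non-collapse needs only that the centre
is not higher than the `l₀`-contracted shell point (two chord inequalities: `lowCentre_persists`,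
`contracted_le_of_lowCentre`); `hmono_of_lowCentre` = part 28's `hmono` binder verbatim for
`g p = 𝟙_{K p.1}(p.2)·e^{−φ_{p.1}(p.2)}`; certified by a first-order model (`lowCentre_certificate`: `2G∕γ ≤ l₀(θ(1−ρ)−c₀)∕L`);
Card 79's argmin is the case `G = 0` (`lowCentre_of_minOn`).  §B (Card 82): the LINEAR centre (Gaussian conditional mean)
is measurable for free; its response is a product of two decaying kernels (`comp_kernel_decay`); the collar width making
the core reading `≤ θ(1−ρ)∕2` is logarithmic in the threshold ratio (`coreReading_le_half_of_collarWidth`).  §C (Card 83):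
core letters keep the centre and ride in `K`; collar letters are mapped into RELAXED letters (the envelope), exits come
only from the inner shell — odds by parts 21 ∕ n21-e 38i.  Kernel letters (B₀, δ₀: [CMP 99] (3.187); coupling block
p.428) are LOCATED (desk ROW Q′), not asserted.

HONEST FRAMING.  [textbook] convexity ∕ finite sums ∕ measurability; 0 def, 0 sorry; nothing of Bałaban's asserted; NE7c
NOT PRINTED ∕ NOT proved; N21 NOT discharged; counts unmoved (typed 28∕28 · discharged 5∕27); count-neutral; one finite
𝕋⁴ at fixed ε — nothing about ℝ⁴ ∕ OS ∕ mass gap ∕ Clay.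
-/

open MeasureTheory Set Function Matrix
open scoped ENNReal

namespace Summit.QuantumFields.YangMills.Theorems.N21LowCentreNonCollapse

/-! ## §A  Card 81 — a LOW centre suffices for radial non-collapse on the shell -/

section LowCentre

variable {V : Type*} [AddCommGroup V] [Module ℝ V]

/-- **A LOW CENTRE STAYS LOW OUTWARD ALONG THE RAY.**  `φ` convex on convex `K`, `m, w ∈ K`, `0 < l₀ ≤ l ≤ 1`:
`φ m ≤ φ (m + l₀ • (w − m))` implies `φ m ≤ φ (m + l • (w − m))`.  Proof: `m + l₀(w−m)` is the convex combination
`(1 − l₀∕l)·m + (l₀∕l)·(m + l(w−m))`. [textbook] -/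
theorem lowCentre_persists {K : Set V} {φ : V → ℝ} (hK : Convex ℝ K) (hφ : ConvexOn ℝ K φ) {m w : V}
    (hm : m ∈ K) (hw : w ∈ K) {l₀ l : ℝ} (hl₀ : 0 < l₀) (hl₀l : l₀ ≤ l) (hl1 : l ≤ 1)
    (hlow : φ m ≤ φ (m + l₀ • (w - m))) : φ m ≤ φ (m + l • (w - m)) := by
  have hl : 0 < l := hl₀.trans_le hl₀l
  have hyK : m + l • (w - m) ∈ K := hK.add_smul_sub_mem hm hw ⟨hl.le, hl1⟩
  have hb : 0 < l₀ / l := div_pos hl₀ hl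
  have hb1 : l₀ / l ≤ 1 := div_le_one_of_le₀ hl₀l hl.le
  have heq : (1 - l₀ / l) • m + (l₀ / l) • (m + l • (w - m)) = m + l₀ • (w - m) := by
    have hc : l₀ / l * l = l₀ := div_mul_cancel₀ l₀ hl.ne'
    rw [smul_add, smul_smul, hc, sub_smul, one_smul]
    abel
  have hconv := hφ.2 hm hyK (show (0 : ℝ) ≤ 1 - l₀ / l by linarith) hb.le (by ring)
  rw [heq] at hconv
  simp only [smul_eq_mul] at hconv
  have h2 : l₀ / l * φ m ≤ l₀ / l * φ (m + l • (w - m)) := by linarith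
  exact le_of_mul_le_mul_left h2 hb

/-- **THE CONTRACTED POINT IS NOT HIGHER THAN THE ENDPOINT.**  `φ` convex on convex `K`, `m, w ∈ K`, `0 < l ≤ 1`,
`φ m ≤ φ (m + l • (w − m))` ⇒ `φ (m + l • (w − m)) ≤ φ w`.  Proof: `m + l(w−m) = (1−l)m + lw`, so
`φ(·) ≤ (1−l)φ m + lφ w ≤ (1−l)φ(·) + lφ w`. [textbook] -/
theorem contracted_le_of_lowCentre {K : Set V} {φ : V → ℝ} (hφ : ConvexOn ℝ K φ) {m w : V}
    (hm : m ∈ K) (hw : w ∈ K) {l : ℝ} (hl : 0 < l) (hl1 : l ≤ 1)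
    (hlow : φ m ≤ φ (m + l • (w - m))) : φ (m + l • (w - m)) ≤ φ w := by
  have heq : (1 - l) • m + l • w = m + l • (w - m) := by
    rw [smul_sub, sub_smul, one_smul]
    abel
  have hconv := hφ.2 hm hw (show (0 : ℝ) ≤ 1 - l by linarith) hl.le (by ring)
  rw [heq] at hconv
  simp only [smul_eq_mul] at hconv
  have h3 : 0 ≤ (1 - l) * (φ (m + l • (w - m)) - φ m) := mul_nonneg (by linarith) (by linarith)
  have h2 : l * φ (m + l • (w - m)) ≤ l * φ w := by nlinarith
  exact le_of_mul_le_mul_left h2 hl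

/-- **★ CARD 81: RADIAL NON-COLLAPSE ABOUT ANY LOW CENTRE.**  `φ` convex on convex `K`, `m, w ∈ K`, `0 < l₀ ≤ 1`,
`φ m ≤ φ (m + l₀ • (w − m))` ⇒ `φ (m + l • (w − m)) ≤ φ w` for every `l ∈ [l₀, 1]`.  The centre need NOT be the
minimiser; no stationarity, no uniqueness, no measurable selection. [textbook] -/
theorem radialMono_about_lowCentre {K : Set V} {φ : V → ℝ} (hK : Convex ℝ K) (hφ : ConvexOn ℝ K φ) {m w : V}
    (hm : m ∈ K) (hw : w ∈ K) {l₀ : ℝ} (hl₀ : 0 < l₀) (hlow : φ m ≤ φ (m + l₀ • (w - m)))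
    {l : ℝ} (hl : l ∈ Icc l₀ 1) : φ (m + l • (w - m)) ≤ φ w :=
  contracted_le_of_lowCentre hφ hm hw (hl₀.trans_le hl.1) hl.2
    (lowCentre_persists hK hφ hm hw hl₀ hl.1 hl.2 hlow)

/-- density form: `e^{−φ}` does not collapse under the contraction toward a low centre. [textbook] -/
theorem nonCollapse_about_lowCentre {K : Set V} {φ : V → ℝ} (hK : Convex ℝ K) (hφ : ConvexOn ℝ K φ) {m w : V}
    (hm : m ∈ K) (hw : w ∈ K) {l₀ : ℝ} (hl₀ : 0 < l₀) (hlow : φ m ≤ φ (m + l₀ • (w - m)))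
    {l : ℝ} (hl : l ∈ Icc l₀ 1) : Real.exp (-φ w) ≤ Real.exp (-φ (m + l • (w - m))) :=
  Real.exp_le_exp.2 (neg_le_neg (radialMono_about_lowCentre hK hφ hm hw hl₀ hlow hl))

/-- Card 79 is the special case «the centre minimises `φ` on `K`» (then every contracted point is trivially not
lower than the centre). [textbook] -/
theorem lowCentre_of_minOn {K : Set V} (hK : Convex ℝ K) {φ : V → ℝ} {m w : V} (hm : m ∈ K) (hw : w ∈ K)
    (hmin : ∀ v ∈ K, φ m ≤ φ v) {l₀ : ℝ} (hl₀ : 0 ≤ l₀) (hl₀1 : l₀ ≤ 1) :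
    φ m ≤ φ (m + l₀ • (w - m)) :=
  hmin _ (hK.add_smul_sub_mem hm hw ⟨hl₀, hl₀1⟩)

end LowCentre

section Plug

/-- **THE P2 BINDER, VERBATIM.**  In the product frame `X × (κ → ℝ)` of parts 27–28 (exterior point `z = p.1`, block
chart `w = p.2`), with the density `g p = 𝟙_{K z}(w)·e^{−φ_z(w)}` (kept CONVEX cuts `K z` in the block variables,
block potential `φ_z`), a measurable centre `m z ∈ K z` that is LOW seen from the shell ∩ cut gives part 28's
non-collapse hypothesis `hmono` of `slotAntiConcentration_restrict_of_recentredDilation` on the nose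
(`l₀ = 1 − 1∕(#κ+1)` there). [textbook] -/
theorem hmono_of_lowCentre {X : Type*} {κ : Type*} (K : X → Set (κ → ℝ)) (φ : X → (κ → ℝ) → ℝ)
    (m : X → (κ → ℝ)) (U : X × (κ → ℝ) → ℝ) (C : Set (X × (κ → ℝ))) {θ ρ l₀ : ℝ}
    (hK : ∀ z, Convex ℝ (K z)) (hφ : ∀ z, ConvexOn ℝ (K z) (φ z)) (hmK : ∀ z, m z ∈ K z) (hl₀ : 0 < l₀)
    (hlow : ∀ p : X × (κ → ℝ), θ * (1 - ρ) ≤ U p → U p < θ → p ∈ C → p.2 ∈ K p.1 →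
      φ p.1 (m p.1) ≤ φ p.1 (m p.1 + l₀ • (p.2 - m p.1))) :
    ∀ l ∈ Icc l₀ 1, ∀ p : X × (κ → ℝ), θ * (1 - ρ) ≤ U p → U p < θ → p ∈ C →
      (K p.1).indicator (fun w => ENNReal.ofReal (Real.exp (-φ p.1 w))) p.2
        ≤ (K p.1).indicator (fun w => ENNReal.ofReal (Real.exp (-φ p.1 w))) (m p.1 + l • (p.2 - m p.1)) := by
  intro l hl p h1 h2 h3
  by_cases hw : p.2 ∈ K p.1
  · have hin : m p.1 + l • (p.2 - m p.1) ∈ K p.1 :=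
      (hK p.1).add_smul_sub_mem (hmK p.1) hw ⟨(hl₀.trans_le hl.1).le, hl.2⟩
    rw [indicator_of_mem hw, indicator_of_mem hin]
    exact ENNReal.ofReal_le_ofReal
      (nonCollapse_about_lowCentre (hK p.1) (hφ p.1) (hmK p.1) hw hl₀ (hlow p h1 h2 h3 hw) hl)
  · rw [indicator_of_notMem hw]
    exact bot_le

end Plug

section Certificate

variable {V : Type*} [NormedAddCommGroup V]

/-- **FIRST-ORDER MODEL ⇒ LOW CENTRE.**  If `φ v ≥ φ m − G‖v − m‖ + (γ∕2)‖v − m‖²` on `K` (a `γ`-strongly convex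
potential about `m` whose gradient at `m` has norm `≤ G` — for the Gaussian conditional mean `m₀` the gradient is the
block gradient of the non-quadratic part only), then every `v ∈ K` with `‖v − m‖ ≥ 2G∕γ` satisfies `φ m ≤ φ v`.
[textbook] -/
theorem lowCentre_of_firstOrderModel {K : Set V} {φ : V → ℝ} {m : V} {G γ : ℝ} (hγ : 0 < γ)
    (hmodel : ∀ v ∈ K, φ m - G * ‖v - m‖ + γ / 2 * ‖v - m‖ ^ 2 ≤ φ v) {v : V} (hv : v ∈ K)
    (hfar : 2 * G / γ ≤ ‖v - m‖) : φ m ≤ φ v := by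
  have hr : 0 ≤ ‖v - m‖ := norm_nonneg _
  have h1 : 2 * G ≤ ‖v - m‖ * γ := by rwa [div_le_iff₀ hγ] at hfar
  have h2 : 0 ≤ -(G * ‖v - m‖) + γ / 2 * ‖v - m‖ ^ 2 := by nlinarith
  linarith [hmodel v hv]

/-- the statistic reads the distance: `U` `L`-Lipschitz (one-sided suffices), `U m ≤ c₀`, `a ≤ U w` ⇒
`(a − c₀)∕L ≤ ‖w − m‖`. [textbook] -/
theorem norm_sub_ge_of_reading {U : V → ℝ} {L : ℝ} (hL : 0 < L) (hU : ∀ a b : V, U a - U b ≤ L * ‖a - b‖)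
    {m w : V} {c₀ a : ℝ} (hm : U m ≤ c₀) (hw : a ≤ U w) : (a - c₀) / L ≤ ‖w - m‖ := by
  rw [div_le_iff₀ hL]
  have := hU w m
  linarith

variable [NormedSpace ℝ V]

/-- **★ THE LOW-CENTRE CERTIFICATE AT A SHELL POINT.**  Strong convexity `γ` about `m` with gradient residual `G`,
an `L`-Lipschitz statistic, core reading `U m ≤ c₀`, a shell point `θ(1−ρ) ≤ U w`, and the one located inequality
`2G∕γ ≤ l₀·(θ(1−ρ) − c₀)∕L` give the low-centre hypothesis of `radialMono_about_lowCentre`. [textbook] -/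
theorem lowCentre_certificate {K : Set V} (hK : Convex ℝ K) {φ U : V → ℝ} {m w : V}
    {G γ L c₀ θ ρ l₀ : ℝ} (hγ : 0 < γ) (hL : 0 < L) (hl₀ : 0 < l₀) (hl₀1 : l₀ ≤ 1)
    (hmodel : ∀ v ∈ K, φ m - G * ‖v - m‖ + γ / 2 * ‖v - m‖ ^ 2 ≤ φ v)
    (hU : ∀ a b : V, U a - U b ≤ L * ‖a - b‖) (hm : m ∈ K) (hw : w ∈ K)
    (hUm : U m ≤ c₀) (hUw : θ * (1 - ρ) ≤ U w)
    (hnum : 2 * G / γ ≤ l₀ * ((θ * (1 - ρ) - c₀) / L)) :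
    φ m ≤ φ (m + l₀ • (w - m)) := by
  refine lowCentre_of_firstOrderModel hγ hmodel (hK.add_smul_sub_mem hm hw ⟨hl₀.le, hl₀1⟩) ?_
  have hdist := norm_sub_ge_of_reading hL hU hUm hUw
  have hn : ‖m + l₀ • (w - m) - m‖ = l₀ * ‖w - m‖ := by
    rw [add_sub_cancel_left, norm_smul, Real.norm_of_nonneg hl₀.le]
  rw [hn]
  exact hnum.trans (mul_le_mul_of_nonneg_left hdist hl₀.le)

end Certificate

section QuadraticPart

variable {κ : Type*} [Fintype κ]

/-- **THE QUADRATIC PART IS MINIMISED EXACTLY AT THE LINEAR CENTRE (gap identity).**  For a symmetric matrix `A`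
and `A m + b = 0` (the Gaussian conditional mean of the block given the exterior: `b` = coupling × exterior data),
`(½⟨w,Aw⟩ + ⟨b,w⟩) − (½⟨m,Am⟩ + ⟨b,m⟩) = ½⟨w−m, A(w−m)⟩`. [textbook] -/
theorem quadGap_eq (A : Matrix κ κ ℝ) (hA : A.IsSymm) (b m : κ → ℝ) (hm : A *ᵥ m + b = 0) (w : κ → ℝ) :
    (1 / 2 * (w ⬝ᵥ (A *ᵥ w)) + b ⬝ᵥ w) - (1 / 2 * (m ⬝ᵥ (A *ᵥ m)) + b ⬝ᵥ m)
      = 1 / 2 * ((w - m) ⬝ᵥ (A *ᵥ (w - m))) := by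
  have hb : b = -(A *ᵥ m) := eq_neg_of_add_eq_zero_right hm
  have hsym : ∀ x y : κ → ℝ, x ⬝ᵥ (A *ᵥ y) = y ⬝ᵥ (A *ᵥ x) := by
    intro x y
    rw [Matrix.dotProduct_mulVec, ← Matrix.mulVec_transpose, hA.eq, dotProduct_comm]
  subst hb
  rw [Matrix.mulVec_sub, dotProduct_sub, sub_dotProduct, sub_dotProduct, neg_dotProduct, neg_dotProduct,
    hsym m w, dotProduct_comm (A *ᵥ m) w, dotProduct_comm (A *ᵥ m) m]
  ring

/-- **FIRST-ORDER MODEL ABOUT THE LINEAR CENTRE: the gradient residual is the NON-QUADRATIC part's only.**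
`φ = ½⟨·,A·⟩ + ⟨b,·⟩ + P` with `A` symmetric, `γ‖x‖² ≤ ⟨x,Ax⟩` (any norm), `A m + b = 0`, and `P m − P v ≤ G‖v − m‖`
on `K` ⇒ the model hypothesis `hmodel` of `lowCentre_of_firstOrderModel` ∕ `lowCentre_certificate` with THIS `G`
(for Bałaban's block action: `G = O(‖∇_Λ P^{(k)}‖)`, small; `γ = γ₀` the uniform lower bound of `Δ_k`). [textbook] -/
theorem firstOrderModel_about_linearCentre (A : Matrix κ κ ℝ) (hA : A.IsSymm) (b m : κ → ℝ)
    (hm : A *ᵥ m + b = 0) {γ G : ℝ} (hγ : ∀ x : κ → ℝ, γ * ‖x‖ ^ 2 ≤ x ⬝ᵥ (A *ᵥ x))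
    (P : (κ → ℝ) → ℝ) (K : Set (κ → ℝ)) (hP : ∀ v ∈ K, P m - P v ≤ G * ‖v - m‖) :
    ∀ v ∈ K, (1 / 2 * (m ⬝ᵥ (A *ᵥ m)) + b ⬝ᵥ m + P m) - G * ‖v - m‖ + γ / 2 * ‖v - m‖ ^ 2
      ≤ 1 / 2 * (v ⬝ᵥ (A *ᵥ v)) + b ⬝ᵥ v + P v := by
  intro v hv
  have h1 := quadGap_eq A hA b m hm v
  have h2 := hγ (v - m)
  have h3 := hP v hv
  linarith

end QuadraticPart

/-! ## §B  Card 82 — the linear centre: measurable for free; response = composition of two decaying kernels; collar width -/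

section Kernel

variable {Sx Su Sy : Type*}

/-- **THE LINEAR CENTRE IS MEASURABLE (no selection theorem).**  `z ↦ (Σ_y R(x,y) z_y)_x`. [textbook] -/
theorem measurable_linearCentre [Fintype Sy] (R : Sx → Sy → ℝ) :
    Measurable (fun z : Sy → ℝ => fun x : Sx => ∑ y, R x y * z y) := by
  refine measurable_pi_lambda _ fun x => ?_
  exact Finset.measurable_sum _ fun y _ => (measurable_pi_apply y).const_mul _

/-- **COMPOSITION OF TWO DECAYING KERNELS DECAYS AT HALF RATE.**  `|K₁(x,u)| ≤ B₁e^{−δd₁(x,u)}`,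
`|K₂(u,y)| ≤ B₂e^{−δd₂(u,y)}`, `d(x,y) ≤ d₁(x,u) + d₂(u,y)`, `d₂ ≥ 0`, `Σ_u e^{−(δ∕2)d₁(x,u)} ≤ C` ⇒
`|Σ_u K₁(x,u)K₂(u,y)| ≤ B₁B₂C·e^{−(δ∕2)d(x,y)}`.  With `K₁ = C^{(k)}(Λ)` ([Bałaban CMP 99] (3.187)) and `K₂` = the
block–exterior coupling of the fluctuation form this is the response kernel of the linear centre. [textbook] -/
theorem comp_kernel_decay [Fintype Su] (K₁ : Sx → Su → ℝ) (K₂ : Su → Sy → ℝ) (d₁ : Sx → Su → ℝ)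
    (d₂ : Su → Sy → ℝ) (d : Sx → Sy → ℝ) {B₁ B₂ δ C : ℝ} (hB₁ : 0 ≤ B₁) (hB₂ : 0 ≤ B₂) (hδ : 0 ≤ δ)
    (hK₁ : ∀ x u, |K₁ x u| ≤ B₁ * Real.exp (-(δ * d₁ x u)))
    (hK₂ : ∀ u y, |K₂ u y| ≤ B₂ * Real.exp (-(δ * d₂ u y)))
    (htri : ∀ x u y, d x y ≤ d₁ x u + d₂ u y) (hd₂ : ∀ u y, 0 ≤ d₂ u y)
    (hC : ∀ x, ∑ u, Real.exp (-(δ / 2 * d₁ x u)) ≤ C) (x : Sx) (y : Sy) :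
    |∑ u, K₁ x u * K₂ u y| ≤ B₁ * B₂ * C * Real.exp (-(δ / 2 * d x y)) := by
  calc |∑ u, K₁ x u * K₂ u y| ≤ ∑ u, |K₁ x u * K₂ u y| := Finset.abs_sum_le_sum_abs _ _
    _ ≤ ∑ u, B₁ * Real.exp (-(δ * d₁ x u)) * (B₂ * Real.exp (-(δ * d₂ u y))) :=
        Finset.sum_le_sum fun u _ => by
          rw [abs_mul]
          exact mul_le_mul (hK₁ x u) (hK₂ u y) (abs_nonneg _) (by positivity)
    _ ≤ ∑ u, B₁ * B₂ * (Real.exp (-(δ / 2 * d x y)) * Real.exp (-(δ / 2 * d₁ x u))) :=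
        Finset.sum_le_sum fun u _ => by
          have h1 : B₁ * Real.exp (-(δ * d₁ x u)) * (B₂ * Real.exp (-(δ * d₂ u y)))
              = B₁ * B₂ * Real.exp (-(δ * d₁ x u) + -(δ * d₂ u y)) := by
            rw [Real.exp_add]; ring
          rw [h1, ← Real.exp_add]
          refine mul_le_mul_of_nonneg_left (Real.exp_le_exp.2 ?_) (mul_nonneg hB₁ hB₂)
          have ht := mul_le_mul_of_nonneg_left (htri x u y) hδ
          have hp := mul_nonneg hδ (hd₂ u y)
          nlinarith
    _ = B₁ * B₂ * Real.exp (-(δ / 2 * d x y)) * ∑ u, Real.exp (-(δ / 2 * d₁ x u)) := by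
        rw [Finset.mul_sum]
        exact Finset.sum_congr rfl fun u _ => by ring
    _ ≤ B₁ * B₂ * Real.exp (-(δ / 2 * d x y)) * C := mul_le_mul_of_nonneg_left (hC x) (by positivity)
    _ = B₁ * B₂ * C * Real.exp (-(δ / 2 * d x y)) := by ring

/-- **THE COLLAR WIDTH IS LOGARITHMIC IN THE THRESHOLD RATIO.**  If `w ≥ (2∕δ)·log(2BCΘ∕(θ(1−ρ)))` then the core
reading bound of part 29 (`core_reading_le_of_kernelDecay`: `B·C·e^{−δw∕2}·Θ`) is at most `θ(1−ρ)∕2`, so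
`κ₀ ≥ 1∕2` (`kappa_ge_half`).  Only the RATIO of the exterior thresholds `Θ` to the slot threshold `θ` enters. [textbook] -/
theorem coreReading_le_half_of_collarWidth {B C Θ θ ρ δ w : ℝ} (hB : 0 < B) (hC : 0 < C) (hΘ : 0 < Θ)
    (hθ : 0 < θ) (hρ : ρ < 1) (hδ : 0 < δ)
    (hw : 2 / δ * Real.log (2 * B * C * Θ / (θ * (1 - ρ))) ≤ w) :
    B * C * Real.exp (-(δ / 2 * w)) * Θ ≤ θ * (1 - ρ) / 2 := by
  have hpos : 0 < θ * (1 - ρ) := mul_pos hθ (by linarith)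
  set Xr : ℝ := 2 * B * C * Θ / (θ * (1 - ρ)) with hX
  have hXpos : 0 < Xr := div_pos (by positivity) hpos
  have h1 : Real.log Xr ≤ δ / 2 * w := by
    have h := mul_le_mul_of_nonneg_left hw (show (0 : ℝ) ≤ δ / 2 by positivity)
    have h' : δ / 2 * (2 / δ * Real.log Xr) = Real.log Xr := by
      field_simp
    linarith
  have h2 : Real.exp (-(δ / 2 * w)) ≤ Xr⁻¹ :=
    calc Real.exp (-(δ / 2 * w)) ≤ Real.exp (-Real.log Xr) := Real.exp_le_exp.2 (by linarith)
      _ = Xr⁻¹ := by rw [Real.exp_neg, Real.exp_log hXpos]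
  calc B * C * Real.exp (-(δ / 2 * w)) * Θ ≤ B * C * Xr⁻¹ * Θ := by gcongr
    _ = θ * (1 - ρ) / 2 := by
        rw [hX]
        field_simp

end Kernel

/-! ## §C  Card 83 — kept letters split by support: core letters keep the centre, collar letters exit only from a left shell -/

section Letters

variable {Sx Sy : Type*} [Fintype Sy]

/-- **CORE LETTERS KEEP THE LINEAR CENTRE (membership by decay).**  If the centre's core reading is `≤ c₀ < θc`
(part 29's decay bound) then the centre satisfies every core letter `|v_x| < θc`. [textbook] -/
theorem linearCentre_mem_coreBox (R : Sx → Sy → ℝ) (core : Set Sx) {c₀ θc : ℝ} (z : Sy → ℝ)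
    (hcore : ∀ x ∈ core, |∑ y, R x y * z y| ≤ c₀) (hc : c₀ < θc) :
    (fun x => ∑ y, R x y * z y) ∈ {v : Sx → ℝ | ∀ x ∈ core, |v x| < θc} :=
  fun x hx => (hcore x hx).trans_lt hc

end Letters

section Collar

/-- the contraction toward `m_b` moves `|·|` by at most `(1−l)(|w_b| + |m_b|)`. [textbook] -/
theorem abs_contract_le {mb wb l : ℝ} (hl1 : l ≤ 1) :
    |mb + l * (wb - mb)| ≤ |wb| + (1 - l) * (|wb| + |mb|) := by
  have hrw : mb + l * (wb - mb) = wb - (1 - l) * (wb - mb) := by ring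
  rw [hrw]
  calc |wb - (1 - l) * (wb - mb)| ≤ |wb| + |(1 - l) * (wb - mb)| := abs_sub _ _
    _ = |wb| + (1 - l) * |wb - mb| := by
        rw [abs_mul, abs_of_nonneg (show (0 : ℝ) ≤ 1 - l by linarith)]
    _ ≤ |wb| + (1 - l) * (|wb| + |mb|) := by
        have := abs_sub wb mb
        have hl' : 0 ≤ 1 - l := by linarith
        nlinarith

/-- **THE `henv` PRODUCER FOR A COLLAR LETTER (image side).**  Under the contraction `w_b ↦ m_b + l(w_b − m_b)`,
`l ∈ [l₀, 1]`, `|m_b| ≤ M`, a coordinate satisfying the sub-level letter `|w_b| < θₑ` lands in the RELAXED letter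
`|·| < θₑ + (1−l₀)(θₑ + M)` — the letter-`b` factor of part 28's envelope `Env`; `Env ∖ C` is then inside the OUTER
shell `θₑ ≤ |w_b| < θₑ + (1−l₀)(θₑ + M)` (`relaxed_diff_subset_outerShell`), whose odds relative to the letter are the
two-sided instance of 38i `condOdds_coord_of_partialSlope` ∕ `collarOddsProduct_of_partialSlopes` (one adapter:
apply it to `x_b` and to `−x_b`).  The centre need NOT satisfy the letter. [textbook] -/
theorem absLetter_image_lt_relaxed {mb wb θe M l l₀ : ℝ} (hl₀l : l₀ ≤ l) (hl1 : l ≤ 1)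
    (hin : |wb| < θe) (hM : |mb| ≤ M) : |mb + l * (wb - mb)| < θe + (1 - l₀) * (θe + M) := by
  have h1 := abs_contract_le (mb := mb) (wb := wb) hl1
  have h2 : (1 - l) * (|wb| + |mb|) ≤ (1 - l₀) * (θe + M) :=
    mul_le_mul (by linarith) (by linarith [hin.le]) (by positivity) (by linarith)
  linarith

/-- set form in the product frame of parts 27–28: the `R_l`-image of the letter `{|w_b| < θₑ}` lies in the relaxed
letter, for every `l ∈ [l₀, 1]` (the `henv` clause, letter by letter). [textbook] -/
theorem collarImage_mem_relaxedLetter {X : Type*} {κ : Type*} (b : κ) (m : X → (κ → ℝ)) {θe M l l₀ : ℝ}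
    (hl₀l : l₀ ≤ l) (hl1 : l ≤ 1) (hM : ∀ z, |m z b| ≤ M) (p : X × (κ → ℝ)) (hin : |p.2 b| < θe) :
    (p.1, m p.1 + l • (p.2 - m p.1)) ∈ {q : X × (κ → ℝ) | |q.2 b| < θe + (1 - l₀) * (θe + M)} := by
  show |(m p.1 + l • (p.2 - m p.1)) b| < θe + (1 - l₀) * (θe + M)
  simpa only [Pi.add_apply, Pi.smul_apply, Pi.sub_apply, smul_eq_mul] using
    absLetter_image_lt_relaxed hl₀l hl1 hin (hM p.1)

/-- `Env ∖ C` letter by letter: relaxed letter minus letter = the OUTER shell. [textbook] -/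
theorem relaxed_diff_subset_outerShell {X : Type*} {κ : Type*} (b : κ) {θe θe' : ℝ} :
    {q : X × (κ → ℝ) | |q.2 b| < θe'} \ {q | |q.2 b| < θe}
      ⊆ {q | θe ≤ |q.2 b| ∧ |q.2 b| < θe'} :=
  fun _ hq => ⟨not_lt.1 hq.2, hq.1⟩

/-- **EXITS HAPPEN ONLY FROM THE INNER SHELL (pre-image side).**  A coordinate with `|w_b| < θₑ` whose image violates
the letter (`θₑ ≤ |image|`) satisfies `θₑ − (1−l₀)(θₑ + |m_b|) ≤ |w_b|`: the exiting mass is inner-shell mass, of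
ABSOLUTE width `(1−l₀)(θₑ + |m_b|)` (`1 − l₀ = 1∕(#κ+1)` on the dilation road) — the alternative book-keeping
(bound the exiting mass directly instead of enlarging `Env`). [textbook] -/
theorem absLetter_exit_mem_leftShell {mb wb θe l l₀ : ℝ} (hl₀l : l₀ ≤ l) (hl1 : l ≤ 1)
    (hin : |wb| < θe) (hexit : θe ≤ |mb + l * (wb - mb)|) :
    θe - (1 - l₀) * (θe + |mb|) ≤ |wb| := by
  have h1 := abs_contract_le (mb := mb) (wb := wb) hl1
  have h2 : (1 - l) * (|wb| + |mb|) ≤ (1 - l₀) * (θe + |mb|) :=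
    mul_le_mul (by linarith) (by linarith [hin.le]) (by positivity) (by linarith)
  linarith

/-- set form (pre-image side), product frame. [textbook] -/
theorem collarExit_subset_leftShell {X : Type*} {κ : Type*} (b : κ) (m : X → (κ → ℝ)) {θe M l l₀ : ℝ}
    (hl₀l : l₀ ≤ l) (hl1 : l ≤ 1) (hM : ∀ z, |m z b| ≤ M) :
    {p : X × (κ → ℝ) | |p.2 b| < θe ∧ θe ≤ |(m p.1 + l • (p.2 - m p.1)) b|}
      ⊆ {p | θe - (1 - l₀) * (θe + M) ≤ |p.2 b| ∧ |p.2 b| < θe} := by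
  rintro p ⟨hin, hexit⟩
  refine ⟨?_, hin⟩
  have hex' : θe ≤ |m p.1 b + l * (p.2 b - m p.1 b)| := by
    simpa only [Pi.add_apply, Pi.smul_apply, Pi.sub_apply, smul_eq_mul] using hexit
  have h := absLetter_exit_mem_leftShell hl₀l hl1 hin hex'
  have hMb := hM p.1
  have hl₀1 : 0 ≤ 1 - l₀ := by linarith
  nlinarith

end Collar

end Summit.QuantumFields.YangMills.Theorems.N21LowCentreNonCollapse
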